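import Summits.Ventures.HodgeRepro2.T5SU11SphericalLpSharp

/-!
# Harish-Chandra's logarithmic estimate for `Ξ = φ₁` on `SU(1,1)`:
`(1/8) (1 + t) e^{-t} ≤ Ξ(a_t) ≤ 8 (1 + t) e^{-t}` for `t ≥ 0`

At the critical parameter `λ = 1` (`= ρ`) the asymptotics of `T5SU11SphericalAsymptotic` break down
(`c(λ) → ∞`, see `cfun`): the rescaled Laplace integral
`e^{t} Ξ(a_t) = (2π)⁻¹ ∫_{-π}^{π} (sin²(φ/2) + e^{-4t} cos²(φ/2))^{-1/2} dφ`
(`T5SU11SphericalAsymptotic.exp_mul_sph_hyp_eq` at `λ = 1`, with `(1 - cos φ)/2 = sin²(φ/2)` and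
`(1 + cos φ)/2 = cos²(φ/2)`, `one_add_cos_div_two`) grows like a logarithm. Writing `ε = e^{-2t} ≤ 1`:
Jordan's inequalities `sin²(φ/2) ≥ (φ/π)²` and `cos(φ/2) ≥ 1 - |φ|/π` on `[-π, π]`
(`one_sub_abs_div_pi_le_cos_half`) give the **lower bound on the base**
`sin²(φ/2) + ε² cos²(φ/2) ≥ ((|φ|/π + ε)/4)²` (`rescaled_base_ge`, through the elementary
`((v + ε)/4)² ≤ v² + ε²(1 - v)²` for `0 ≤ v ≤ 1`, `0 < ε ≤ 1`, `key_lower`), while `sin²(φ/2) ≤ (φ/2)²`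
and `cos² ≤ 1` give the **upper bound** `≤ (|φ|/2 + ε)²` (`rescaled_base_le`). Hence the integrand is
squeezed between `(|φ|/2 + ε)⁻¹` and `4 (|φ|/π + ε)⁻¹` (`rescaled_rpow_ge`, `rescaled_rpow_le`), and
`∫_{-π}^{π} (|φ|/c + a)⁻¹ dφ = 2c log ((π/c + a)/a)` (`integral_inv_abs_div_add`, by the fundamental
theorem of calculus on `[0, π]` and evenness). The result:
**`(2/π) log ((π/2) e^{2t} + 1) ≤ e^{t} Ξ(a_t) ≤ 4 log (e^{2t} + 1)`** (`le_exp_mul_sph_one_hyp`,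
`exp_mul_sph_one_hyp_le`), and with `log 2 ≤ 1`, `log (π/2) ≥ 1 - 2/π ≥ 1/3`, `3 < π ≤ 4`:
**`(1/8) (1 + t) e^{-t} ≤ Ξ(a_t) ≤ 8 (1 + t) e^{-t}` for all `t ≥ 0`** (`le_sph_one_hyp`,
`sph_one_hyp_le`) — Harish-Chandra's `Ξ(a_t) ≍ (1 + t) e^{-t}` (the `Ξ(a) ≤ C (1 + ‖log a‖)^d a^{-ρ}`
estimate, `d = 1`, in the explicit model); on the whole group `Ξ(g) ≍ (1 + T) e^{-T}` with
`T = cartanT g` (`sph_one_le_cartanT`, `le_sph_one_cartanT`) and `Ξ(g) ≤ 8 (1 + log (2|a(g)|)) / |a(g)|`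
in terms of the matrix entry `|a(g)| = cosh T` (`sph_one_le_norm_mat`). Nothing is claimed about (N).

Blind lane: Mathlib + the HodgeRepro2 prefix only; no sorry; axioms ⊆ {propext, Classical.choice,
Quot.sound}.
-/

namespace Summit.Ventures.HodgeRepro2.T5SU11SphericalXiLog

open MeasureTheory Metric Set Filter Topology Complex intervalIntegral
open T5SU11Unimodular T5SU11Fibration T5SU11Cartan T5SU11OneParameter T5SU11CartanProjection
  T5HaarCircle T5BergmanCoefficient T5SU11SphericalFunction T5SU11SphericalTwo
  T5SU11SphericalSymmetry T5SU11SphericalBounds T5SU11SphericalContinuous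
  T5SU11SphericalAsymptotic T5SU11SphericalLp T5SU11SphericalCfun T5SU11SphericalLpSharp
open scoped Real

/-! ### Elementary trigonometric bounds -/

/-- `(1 + cos φ)/2 = cos (φ/2) ^ 2`. -/
lemma one_add_cos_div_two (φ : ℝ) : (1 + Real.cos φ) / 2 = Real.cos (φ / 2) ^ 2 := by
  rw [Real.cos_sq, show 2 * (φ / 2) = φ by ring]
  ring

/-- **Jordan's inequality for the cosine**: `1 - |φ|/π ≤ cos (φ/2)` for `-π ≤ φ ≤ π`. -/
lemma one_sub_abs_div_pi_le_cos_half {φ : ℝ} (h1 : -π ≤ φ) (h2 : φ ≤ π) :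
    1 - |φ| / π ≤ Real.cos (φ / 2) := by
  have hπ := Real.pi_pos
  have habs : |φ| ≤ π := abs_le.mpr ⟨h1, h2⟩
  have hcos : Real.cos (φ / 2) = Real.cos (|φ| / 2) := by
    rcases le_or_gt 0 φ with h | h
    · rw [abs_of_nonneg h]
    · rw [abs_of_neg h, neg_div, Real.cos_neg]
  rw [hcos, ← Real.sin_pi_div_two_sub]
  have hs := Real.mul_le_sin (x := π / 2 - |φ| / 2) (by linarith) (by linarith [abs_nonneg φ])
  have key : 2 / π * (π / 2 - |φ| / 2) = 1 - |φ| / π := by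
    rw [div_mul_eq_mul_div, show 2 * (π / 2 - |φ| / 2) = π - |φ| by ring, sub_div,
      div_self hπ.ne']
  rw [key] at hs
  exact hs

/-- `(1 - |φ|/π)² ≤ cos (φ/2) ^ 2` for `-π ≤ φ ≤ π`. -/
lemma one_sub_abs_div_pi_sq_le_cos_half_sq {φ : ℝ} (h1 : -π ≤ φ) (h2 : φ ≤ π) :
    (1 - |φ| / π) ^ 2 ≤ Real.cos (φ / 2) ^ 2 := by
  have h0 : 0 ≤ 1 - |φ| / π := by
    rw [sub_nonneg, div_le_one Real.pi_pos]
    exact abs_le.mpr ⟨h1, h2⟩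
  exact pow_le_pow_left₀ h0 (one_sub_abs_div_pi_le_cos_half h1 h2) 2

/-- The elementary inequality behind the lower bound: for `0 ≤ v ≤ 1` and `0 < ε ≤ 1`,
`((v + ε)/4)² ≤ v² + ε² (1 - v)²`. -/
lemma key_lower {v ε : ℝ} (hv0 : 0 ≤ v) (hv1 : v ≤ 1) (hε0 : 0 < ε) (hε1 : ε ≤ 1) :
    ((v + ε) / 4) ^ 2 ≤ v ^ 2 + ε ^ 2 * (1 - v) ^ 2 := by
  have h8 : (v + ε) ^ 2 ≤ 2 * (v ^ 2 + ε ^ 2) := by nlinarith [sq_nonneg (v - ε)]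
  have he : ((v + ε) / 4) ^ 2 = (v + ε) ^ 2 / 16 := by ring
  rw [he]
  have hε2 : ε ^ 2 ≤ 1 := pow_le_one₀ hε0.le hε1
  have hε2' : 0 ≤ ε ^ 2 := sq_nonneg ε
  rcases le_or_gt v (1 / 2) with hv | hv
  · have h14 : 1 / 4 ≤ (1 - v) ^ 2 := by nlinarith
    have := mul_le_mul_of_nonneg_left h14 hε2'
    nlinarith
  · have hv2 : 1 / 4 ≤ v ^ 2 := by nlinarith
    have := mul_nonneg hε2' (sq_nonneg (1 - v))
    nlinarith

/-! ### The two-sided bounds on the rescaled Laplace base -/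

/-- **The lower bound on the rescaled base**: for `t ≥ 0` and `-π ≤ φ ≤ π`,
`((|φ|/π + e^{-2t})/4)² ≤ (1 - cos φ)/2 + e^{-4t} (1 + cos φ)/2`. -/
lemma rescaled_base_ge {t φ : ℝ} (ht : 0 ≤ t) (h1 : -π ≤ φ) (h2 : φ ≤ π) :
    ((|φ| / π + Real.exp (-(2 * t))) / 4) ^ 2 ≤
      (1 - Real.cos φ) / 2 + Real.exp (-(4 * t)) * ((1 + Real.cos φ) / 2) := by
  have hπ := Real.pi_pos
  have hε0 : 0 < Real.exp (-(2 * t)) := Real.exp_pos _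
  have hε1 : Real.exp (-(2 * t)) ≤ 1 := Real.exp_le_one_iff.mpr (by linarith)
  have hv0 : 0 ≤ |φ| / π := by positivity
  have hv1 : |φ| / π ≤ 1 := by
    rw [div_le_one hπ]
    exact abs_le.mpr ⟨h1, h2⟩
  have h4 : Real.exp (-(4 * t)) = Real.exp (-(2 * t)) ^ 2 := by
    rw [sq, ← Real.exp_add]
    congr 1
    ring
  have hsq : (|φ| / π) ^ 2 = (φ / π) ^ 2 := by rw [div_pow, div_pow, sq_abs]
  have hs : (|φ| / π) ^ 2 ≤ Real.sin (φ / 2) ^ 2 := by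
    rw [hsq]
    exact sin_half_sq_ge h1 h2
  have hc := one_sub_abs_div_pi_sq_le_cos_half_sq h1 h2
  rw [h4, one_sub_cos_div_two, one_add_cos_div_two]
  calc ((|φ| / π + Real.exp (-(2 * t))) / 4) ^ 2
      ≤ (|φ| / π) ^ 2 + Real.exp (-(2 * t)) ^ 2 * (1 - |φ| / π) ^ 2 := key_lower hv0 hv1 hε0 hε1
    _ ≤ Real.sin (φ / 2) ^ 2 + Real.exp (-(2 * t)) ^ 2 * Real.cos (φ / 2) ^ 2 :=
        add_le_add hs (mul_le_mul_of_nonneg_left hc (sq_nonneg _))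

/-- **The upper bound on the rescaled base**: for every `t` and `φ`,
`(1 - cos φ)/2 + e^{-4t} (1 + cos φ)/2 ≤ (|φ|/2 + e^{-2t})²`. -/
lemma rescaled_base_le (t φ : ℝ) :
    (1 - Real.cos φ) / 2 + Real.exp (-(4 * t)) * ((1 + Real.cos φ) / 2) ≤
      (|φ| / 2 + Real.exp (-(2 * t))) ^ 2 := by
  have hε0 : 0 < Real.exp (-(2 * t)) := Real.exp_pos _
  have h4 : Real.exp (-(4 * t)) = Real.exp (-(2 * t)) ^ 2 := by
    rw [sq, ← Real.exp_add]
    congr 1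
    ring
  rw [h4, one_sub_cos_div_two, one_add_cos_div_two]
  have hs : Real.sin (φ / 2) ^ 2 ≤ (φ / 2) ^ 2 := Real.sin_sq_le_sq
  have hc : Real.cos (φ / 2) ^ 2 ≤ 1 := Real.cos_sq_le_one (φ / 2)
  have hsq : (φ / 2) ^ 2 = (|φ| / 2) ^ 2 := by rw [div_pow, div_pow, sq_abs]
  have hc' := mul_le_mul_of_nonneg_left hc (sq_nonneg (Real.exp (-(2 * t))))
  have hcross := mul_nonneg (abs_nonneg φ) hε0.le
  nlinarith

/-- `(w²)^{-1/2} = w⁻¹` for `w > 0`. -/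
lemma sq_rpow_neg_half {w : ℝ} (hw : 0 < w) : (w ^ 2) ^ (-1 / 2 : ℝ) = w⁻¹ := by
  rw [← Real.rpow_natCast, ← Real.rpow_mul hw.le, show ((2 : ℕ) : ℝ) * (-1 / 2) = -1 by norm_num,
    Real.rpow_neg_one]

/-- **The pointwise upper bound on the integrand**: for `t ≥ 0`, `-π ≤ φ ≤ π`,
`((1 - cos φ)/2 + e^{-4t}(1 + cos φ)/2)^{-1/2} ≤ 4 (|φ|/π + e^{-2t})⁻¹`. -/
lemma rescaled_rpow_le {t φ : ℝ} (ht : 0 ≤ t) (h1 : -π ≤ φ) (h2 : φ ≤ π) :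
    ((1 - Real.cos φ) / 2 + Real.exp (-(4 * t)) * ((1 + Real.cos φ) / 2)) ^ (-1 / 2 : ℝ) ≤
      4 * (|φ| / π + Real.exp (-(2 * t)))⁻¹ := by
  have hw : 0 < (|φ| / π + Real.exp (-(2 * t))) / 4 := by positivity
  calc ((1 - Real.cos φ) / 2 + Real.exp (-(4 * t)) * ((1 + Real.cos φ) / 2)) ^ (-1 / 2 : ℝ)
      ≤ (((|φ| / π + Real.exp (-(2 * t))) / 4) ^ 2) ^ (-1 / 2 : ℝ) :=
        Real.rpow_le_rpow_of_nonpos (by positivity) (rescaled_base_ge ht h1 h2) (by norm_num)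
    _ = 4 * (|φ| / π + Real.exp (-(2 * t)))⁻¹ := by
        rw [sq_rpow_neg_half hw, inv_div, div_eq_mul_inv]

/-- **The pointwise lower bound on the integrand**:
`(|φ|/2 + e^{-2t})⁻¹ ≤ ((1 - cos φ)/2 + e^{-4t}(1 + cos φ)/2)^{-1/2}`. -/
lemma rescaled_rpow_ge (t φ : ℝ) :
    (|φ| / 2 + Real.exp (-(2 * t)))⁻¹ ≤
      ((1 - Real.cos φ) / 2 + Real.exp (-(4 * t)) * ((1 + Real.cos φ) / 2)) ^ (-1 / 2 : ℝ) := by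
  have hw : 0 < |φ| / 2 + Real.exp (-(2 * t)) := by positivity
  calc (|φ| / 2 + Real.exp (-(2 * t)))⁻¹
      = ((|φ| / 2 + Real.exp (-(2 * t))) ^ 2) ^ (-1 / 2 : ℝ) := (sq_rpow_neg_half hw).symm
    _ ≤ _ := Real.rpow_le_rpow_of_nonpos (rescaled_base_pos t φ) (rescaled_base_le t φ)
        (by norm_num)

/-! ### The logarithmic integrals -/

/-- An even function integrates over `[-b, b]` as twice its integral over `[0, b]`. -/
lemma integral_symm_of_even {f : ℝ → ℝ} (hf : ∀ x, f (-x) = f x) {b : ℝ} (hb : 0 ≤ b)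
    (hint : IntervalIntegrable f volume (-b) b) :
    ∫ x in (-b)..b, f x = 2 * ∫ x in (0 : ℝ)..b, f x := by
  have hmem0 : (0 : ℝ) ∈ uIcc (-b) b := by
    rw [uIcc_of_le (by linarith)]
    exact ⟨by linarith, hb⟩
  have h1 : IntervalIntegrable f volume (-b) 0 :=
    hint.mono_set (uIcc_subset_uIcc left_mem_uIcc hmem0)
  have h2 : IntervalIntegrable f volume 0 b :=
    hint.mono_set (uIcc_subset_uIcc hmem0 right_mem_uIcc)
  rw [← intervalIntegral.integral_add_adjacent_intervals h1 h2]
  have h3 : ∫ x in (-b)..0, f x = ∫ x in (0 : ℝ)..b, f x := by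
    have := intervalIntegral.integral_comp_neg (f := f) (a := 0) (b := b)
    simp only [hf, neg_zero] at this
    exact this.symm
  rw [h3]
  ring

/-- `∫_0^b (x/c + a)⁻¹ dx = c log ((b/c + a)/a)` for `a, c > 0` and `b ≥ 0`. -/
lemma integral_inv_div_add {a c : ℝ} (ha : 0 < a) (hc : 0 < c) {b : ℝ} (hb : 0 ≤ b) :
    ∫ x in (0 : ℝ)..b, (x / c + a)⁻¹ = c * Real.log ((b / c + a) / a) := by
  have hderiv : ∀ x ∈ uIcc (0 : ℝ) b,
      HasDerivAt (fun x => c * Real.log (x / c + a)) (x / c + a)⁻¹ x := by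
    intro x hx
    rw [uIcc_of_le hb] at hx
    have hpos : 0 < x / c + a := by
      have : 0 ≤ x / c := div_nonneg hx.1 hc.le
      linarith
    have h := (((hasDerivAt_id' x).div_const c).add_const a).log hpos.ne'
    have h' := h.const_mul c
    refine h'.congr_deriv ?_
    rw [← mul_div_assoc, mul_one_div, div_self hc.ne', one_div]
  have hint : IntervalIntegrable (fun x => (x / c + a)⁻¹) volume 0 b := by
    apply ContinuousOn.intervalIntegrable
    apply ContinuousOn.inv₀ (by fun_prop)
    intro x hx
    rw [uIcc_of_le hb] at hx
    have : 0 ≤ x / c := div_nonneg hx.1 hc.le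
    exact (by linarith : (0 : ℝ) < x / c + a).ne'
  have hb' : 0 < b / c + a := by
    have : 0 ≤ b / c := div_nonneg hb hc.le
    linarith
  rw [integral_eq_sub_of_hasDerivAt hderiv hint]
  simp only [zero_div, zero_add]
  rw [← mul_sub, ← Real.log_div hb'.ne' ha.ne']

/-- `∫_{-π}^{π} (|φ|/c + a)⁻¹ dφ = 2 c log ((π/c + a)/a)` for `a, c > 0`. -/
lemma integral_inv_abs_div_add {a c : ℝ} (ha : 0 < a) (hc : 0 < c) :
    ∫ φ in (-π)..π, (|φ| / c + a)⁻¹ = 2 * (c * Real.log ((π / c + a) / a)) := by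
  have hcont : Continuous fun φ : ℝ => (|φ| / c + a)⁻¹ := by
    apply Continuous.inv₀ (by fun_prop)
    intro φ
    exact (by positivity : (0 : ℝ) < |φ| / c + a).ne'
  rw [integral_symm_of_even (fun x => by simp only [abs_neg]) Real.pi_pos.le
    (hcont.intervalIntegrable _ _)]
  congr 1
  rw [← integral_inv_div_add ha hc Real.pi_pos.le]
  refine integral_congr fun φ hφ => ?_
  rw [uIcc_of_le Real.pi_pos.le] at hφ
  simp only [abs_of_nonneg hφ.1]

/-! ### Harish-Chandra's logarithmic estimate -/

section measure

variable [MeasurableSpace Circle] [BorelSpace Circle]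

/-- **The upper bound** `e^{t} Ξ(a_t) ≤ 4 log (e^{2t} + 1)` for `t ≥ 0`. -/
theorem exp_mul_sph_one_hyp_le {t : ℝ} (ht : 0 ≤ t) :
    Real.exp t * sph 1 (hyp t) ≤ 4 * Real.log (Real.exp (2 * t) + 1) := by
  have hπ := Real.pi_pos
  have hε0 : 0 < Real.exp (-(2 * t)) := Real.exp_pos _
  have h := exp_mul_sph_hyp_eq 1 t
  rw [one_mul] at h
  rw [h]
  have hmono : ∫ φ in (-π)..π,
      ((1 - Real.cos φ) / 2 + Real.exp (-(4 * t)) * ((1 + Real.cos φ) / 2)) ^ (-(1 : ℝ) / 2) ≤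
      ∫ φ in (-π)..π, 4 * (|φ| / π + Real.exp (-(2 * t)))⁻¹ := by
    refine integral_mono_on (by linarith) ?_ ?_ fun φ hφ => rescaled_rpow_le ht hφ.1 hφ.2
    · exact (Continuous.intervalIntegrable (Continuous.rpow_const (by fun_prop)
        fun φ => Or.inl (rescaled_base_pos t φ).ne') _ _)
    · refine Continuous.intervalIntegrable ?_ _ _
      apply Continuous.mul continuous_const
      apply Continuous.inv₀ (by fun_prop)
      intro φ
      exact (by positivity : (0 : ℝ) < |φ| / π + Real.exp (-(2 * t))).ne'
  rw [intervalIntegral.integral_const_mul, integral_inv_abs_div_add hε0 hπ, div_self hπ.ne']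
    at hmono
  have e : (1 + Real.exp (-(2 * t))) / Real.exp (-(2 * t)) = Real.exp (2 * t) + 1 := by
    rw [add_div, div_self hε0.ne', one_div, ← Real.exp_neg, neg_neg]
  rw [e] at hmono
  calc (2 * π)⁻¹ * ∫ φ in (-π)..π,
        ((1 - Real.cos φ) / 2 + Real.exp (-(4 * t)) * ((1 + Real.cos φ) / 2)) ^ (-(1 : ℝ) / 2)
      ≤ (2 * π)⁻¹ * (4 * (2 * (π * Real.log (Real.exp (2 * t) + 1)))) :=
        mul_le_mul_of_nonneg_left hmono (by positivity)
    _ = 4 * Real.log (Real.exp (2 * t) + 1) := by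
        rw [show (2 * π)⁻¹ * (4 * (2 * (π * Real.log (Real.exp (2 * t) + 1)))) =
          4 * Real.log (Real.exp (2 * t) + 1) * ((2 * π)⁻¹ * (2 * π)) by ring,
          inv_mul_cancel₀ (by positivity), mul_one]

/-- **Harish-Chandra's logarithmic estimate**: `Ξ(a_t) = sph 1 (a_t) ≤ 8 (1 + t) e^{-t}` for
`t ≥ 0`. -/
theorem sph_one_hyp_le {t : ℝ} (ht : 0 ≤ t) :
    sph 1 (hyp t) ≤ 8 * (1 + t) * Real.exp (-t) := by
  have h := exp_mul_sph_one_hyp_le ht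
  have hlog : Real.log (Real.exp (2 * t) + 1) ≤ 1 + 2 * t := by
    have h1 : Real.exp (2 * t) + 1 ≤ 2 * Real.exp (2 * t) := by
      linarith [Real.one_le_exp (by linarith : (0 : ℝ) ≤ 2 * t)]
    calc Real.log (Real.exp (2 * t) + 1) ≤ Real.log (2 * Real.exp (2 * t)) :=
          Real.log_le_log (by positivity) h1
      _ = Real.log 2 + 2 * t := by
          rw [Real.log_mul (by norm_num) (Real.exp_pos _).ne', Real.log_exp]
      _ ≤ 1 + 2 * t := by linarith [Real.log_le_sub_one_of_pos (by norm_num : (0 : ℝ) < 2)]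
  have hpos : 0 < Real.exp t := Real.exp_pos _
  rw [Real.exp_neg, ← div_eq_mul_inv, le_div_iff₀ hpos]
  calc sph 1 (hyp t) * Real.exp t = Real.exp t * sph 1 (hyp t) := mul_comm _ _
    _ ≤ 4 * Real.log (Real.exp (2 * t) + 1) := h
    _ ≤ 4 * (1 + 2 * t) := by linarith
    _ ≤ 8 * (1 + t) := by linarith

/-- **The lower bound** `(2/π) log ((π/2) e^{2t} + 1) ≤ e^{t} Ξ(a_t)` (every `t`). -/
theorem le_exp_mul_sph_one_hyp (t : ℝ) :
    2 / π * Real.log (π / 2 * Real.exp (2 * t) + 1) ≤ Real.exp t * sph 1 (hyp t) := by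
  have hπ := Real.pi_pos
  have hε0 : 0 < Real.exp (-(2 * t)) := Real.exp_pos _
  have h := exp_mul_sph_hyp_eq 1 t
  rw [one_mul] at h
  rw [h]
  have hmono : ∫ φ in (-π)..π, (|φ| / 2 + Real.exp (-(2 * t)))⁻¹ ≤
      ∫ φ in (-π)..π,
        ((1 - Real.cos φ) / 2 + Real.exp (-(4 * t)) * ((1 + Real.cos φ) / 2)) ^ (-(1 : ℝ) / 2) := by
    refine integral_mono_on (by linarith) ?_ ?_ fun φ _ => rescaled_rpow_ge t φ
    · refine Continuous.intervalIntegrable ?_ _ _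
      apply Continuous.inv₀ (by fun_prop)
      intro φ
      exact (by positivity : (0 : ℝ) < |φ| / 2 + Real.exp (-(2 * t))).ne'
    · exact (Continuous.intervalIntegrable (Continuous.rpow_const (by fun_prop)
        fun φ => Or.inl (rescaled_base_pos t φ).ne') _ _)
  rw [integral_inv_abs_div_add hε0 (by norm_num)] at hmono
  have e : (π / 2 + Real.exp (-(2 * t))) / Real.exp (-(2 * t)) =
      π / 2 * Real.exp (2 * t) + 1 := by
    rw [add_div, div_self hε0.ne', div_eq_mul_inv, ← Real.exp_neg, neg_neg]
  rw [e] at hmono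
  calc 2 / π * Real.log (π / 2 * Real.exp (2 * t) + 1)
      = (2 * π)⁻¹ * (2 * (2 * Real.log (π / 2 * Real.exp (2 * t) + 1))) := by ring
    _ ≤ _ := mul_le_mul_of_nonneg_left hmono (by positivity)

/-- **The matching lower bound**: `(1/8) (1 + t) e^{-t} ≤ Ξ(a_t)` for `t ≥ 0`. -/
theorem le_sph_one_hyp {t : ℝ} (ht : 0 ≤ t) :
    1 / 8 * (1 + t) * Real.exp (-t) ≤ sph 1 (hyp t) := by
  have hπ := Real.pi_pos
  have h := le_exp_mul_sph_one_hyp t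
  have hlog : 1 / 3 + 2 * t ≤ Real.log (π / 2 * Real.exp (2 * t) + 1) := by
    have h1 : π / 2 * Real.exp (2 * t) ≤ π / 2 * Real.exp (2 * t) + 1 := by linarith
    have h2 : 1 - 2 / π ≤ Real.log (π / 2) := by
      have := Real.one_sub_inv_le_log_of_pos (by positivity : (0 : ℝ) < π / 2)
      rwa [inv_div] at this
    have h3 : 2 / π ≤ 2 / 3 :=
      div_le_div_of_nonneg_left (by norm_num) (by norm_num) Real.pi_gt_three.le
    calc 1 / 3 + 2 * t ≤ Real.log (π / 2) + 2 * t := by linarith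
      _ = Real.log (π / 2 * Real.exp (2 * t)) := by
          rw [Real.log_mul (by positivity) (Real.exp_pos _).ne', Real.log_exp]
      _ ≤ Real.log (π / 2 * Real.exp (2 * t) + 1) := Real.log_le_log (by positivity) h1
  have hpos : 0 < Real.exp t := Real.exp_pos _
  rw [Real.exp_neg, ← div_eq_mul_inv, div_le_iff₀ hpos]
  have h4 : 2 / π * (1 / 3 + 2 * t) ≤ 2 / π * Real.log (π / 2 * Real.exp (2 * t) + 1) :=
    mul_le_mul_of_nonneg_left hlog (by positivity)
  have h5 : 1 / 8 * (1 + t) ≤ 2 / π * (1 / 3 + 2 * t) := by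
    have hπ4 : 2 / 4 ≤ 2 / π := div_le_div_of_nonneg_left (by norm_num) hπ Real.pi_le_four
    have := mul_le_mul_of_nonneg_right hπ4 (by linarith : (0 : ℝ) ≤ 1 / 3 + 2 * t)
    linarith
  calc 1 / 8 * (1 + t) ≤ 2 / π * (1 / 3 + 2 * t) := h5
    _ ≤ 2 / π * Real.log (π / 2 * Real.exp (2 * t) + 1) := h4
    _ ≤ Real.exp t * sph 1 (hyp t) := h
    _ = sph 1 (hyp t) * Real.exp t := mul_comm _ _

/-- **Harish-Chandra's estimate on the whole group**: `Ξ(g) ≤ 8 (1 + T) e^{-T}`, `T = cartanT g`. -/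
theorem sph_one_le_cartanT (g : SU11) :
    sph 1 g ≤ 8 * (1 + cartanT g) * Real.exp (-cartanT g) := by
  rw [sph_eq_sph_hyp_cartanT]
  exact sph_one_hyp_le (cartanT_nonneg g)

/-- **The lower bound on the whole group**: `(1/8) (1 + T) e^{-T} ≤ Ξ(g)`, `T = cartanT g`. -/
theorem le_sph_one_cartanT (g : SU11) :
    1 / 8 * (1 + cartanT g) * Real.exp (-cartanT g) ≤ sph 1 g := by
  rw [sph_eq_sph_hyp_cartanT]
  exact le_sph_one_hyp (cartanT_nonneg g)

/-- **In terms of the matrix entry** `|a(g)| = cosh (cartanT g)`: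
`Ξ(g) ≤ 8 (1 + log (2 |a(g)|)) / |a(g)|`. -/
theorem sph_one_le_norm_mat (g : SU11) :
    sph 1 g ≤ 8 * (1 + Real.log (2 * ‖mat g 0 0‖)) / ‖mat g 0 0‖ := by
  have hT := cartanT_nonneg g
  have hc : 0 < Real.cosh (cartanT g) := Real.cosh_pos _
  have h1 : Real.exp (-cartanT g) ≤ (Real.cosh (cartanT g))⁻¹ := by
    rw [Real.exp_neg]
    exact inv_anti₀ hc (cosh_le_exp_of_nonneg hT)
  have h2 : cartanT g ≤ Real.log (2 * Real.cosh (cartanT g)) := by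
    rw [Real.le_log_iff_exp_le (by positivity), Real.cosh_eq]
    linarith [(Real.exp_pos (-cartanT g)).le]
  have hl : 0 ≤ Real.log (2 * Real.cosh (cartanT g)) :=
    Real.log_nonneg (by linarith [Real.one_le_cosh (cartanT g)])
  rw [← cosh_cartanT, div_eq_mul_inv]
  calc sph 1 g ≤ 8 * (1 + cartanT g) * Real.exp (-cartanT g) := sph_one_le_cartanT g
    _ ≤ 8 * (1 + Real.log (2 * Real.cosh (cartanT g))) * (Real.cosh (cartanT g))⁻¹ :=
        mul_le_mul (mul_le_mul_of_nonneg_left (by linarith) (by norm_num)) h1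
          (Real.exp_pos _).le (by positivity)

/-- **Harish-Chandra's logarithmic estimate, `∃`-form**: `Ξ(a_t) ≤ C (1 + t) e^{-t}` on `t ≥ 0`. -/
theorem exists_sph_one_hyp_le :
    ∃ C : ℝ, 0 < C ∧ ∀ t : ℝ, 0 ≤ t → sph 1 (hyp t) ≤ C * (1 + t) * Real.exp (-t) :=
  ⟨8, by norm_num, fun _ ht => sph_one_hyp_le ht⟩

/-- **`Ξ(a_t) ≍ (1 + t) e^{-t}`**: two-sided constants `1/8` and `8`. -/
theorem exists_two_sided_sph_one_hyp :
    ∃ c C : ℝ, 0 < c ∧ ∀ t : ℝ, 0 ≤ t →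
      c * (1 + t) * Real.exp (-t) ≤ sph 1 (hyp t) ∧ sph 1 (hyp t) ≤ C * (1 + t) * Real.exp (-t) :=
  ⟨1 / 8, 8, by norm_num, fun _ ht => ⟨le_sph_one_hyp ht, sph_one_hyp_le ht⟩⟩

end measure

end Summit.Ventures.HodgeRepro2.T5SU11SphericalXiLog
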